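import Mathlib

/-!
# Lagrange indicator through polynomial coordinates — stub `stub_indicator` of line `registered`
(crux `NilpotentThresholdDesigns`, stmt-MatrixMultiplication-7720, route `NilpotentLieHosts`)

The line ("recentred identity certificates", the exact `U_d(ℤ)` form of
Blasiak–Cohn–Grochow–Pratt–Umans 2024, Thm 2.10 / Lemma 2.11) builds every separating polynomial
from ONE coordinate chart `u₁, …, u_k` of polynomials in the matrix entries `X_(i,j)` (the variable
`X_(i,j)` has weight `j ∸ i`), whose values on the configuration lie in finite sets `V_i ⊂ ℂ`.
This file proves the multivariate, weighted, through-coordinates LAGRANGE INDICATOR: for target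
values `t_i ∈ V_i` there is one polynomial

`L = ∏_i ∏_{v ∈ V_i ∖ {t_i}} (t_i − v)⁻¹ · (u_i − v)`

with `L(M) = [∀ i, u_i(M) = t_i]` at every point `M` whose coordinates `u_i(M)` lie in `V_i`, and of
weighted degree at most the price of the chart, `Σ_i wdeg(u_i) · (|V_i| − 1)`.

The degree half only uses that the weighted total degree (`MvPolynomial.weightedTotalDegree`, the
`sup` over the support of the additive weight `Finsupp.weight w`) is an `AddMonoidAlgebra.supDegree`,
hence sub-additive under products (`AddMonoidAlgebra.supDegree_mul_le` / `supDegree_prod_le`),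
bounded by the `max` under differences, and `0` on constants.
-/

-- single-conjunct summit: the mandated namespace repeats `MatrixMultiplication`.
set_option linter.dupNamespace false

noncomputable section

open MvPolynomial
open scoped BigOperators Classical

namespace Summit.MatrixMultiplication.MatrixMultiplication.Theorems

namespace NilpotentThresholdDesigns

variable {σ R : Type*} [CommRing R]

/-- The weighted total degree (natural-number weights) is sub-additive under products:
`wdeg (p * q) ≤ wdeg p + wdeg q` (the support of a product lies in the sum of the supports and the
weight is additive). [folklore] -/
theorem weightedTotalDegree_mul_le (w : σ → ℕ) (p q : MvPolynomial σ R) :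
    weightedTotalDegree w (p * q) ≤ weightedTotalDegree w p + weightedTotalDegree w q :=
  AddMonoidAlgebra.supDegree_mul_le (D := fun s => Finsupp.weight w s)
    (map_add (Finsupp.weight w))

/-- The weighted total degree of a finite product is at most the sum of the weighted total
degrees of the factors. [folklore] -/
theorem weightedTotalDegree_prod_le (w : σ → ℕ) {ι : Type*} (s : Finset ι)
    (f : ι → MvPolynomial σ R) :
    weightedTotalDegree w (∏ i ∈ s, f i) ≤ ∑ i ∈ s, weightedTotalDegree w (f i) :=
  AddMonoidAlgebra.supDegree_prod_le (D := fun s => Finsupp.weight w s)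
    (map_zero (Finsupp.weight w)) (map_add (Finsupp.weight w))

/-- The weighted total degree of a difference is at most the larger of the two weighted total
degrees. [folklore] -/
theorem weightedTotalDegree_sub_le (w : σ → ℕ) (p q : MvPolynomial σ R) :
    weightedTotalDegree w (p - q) ≤ max (weightedTotalDegree w p) (weightedTotalDegree w q) :=
  AddMonoidAlgebra.supDegree_sub_le (D := fun s => Finsupp.weight w s)

/-- Constants have weighted total degree `0`. [folklore] -/
theorem weightedTotalDegree_C (w : σ → ℕ) (c : R) :
    weightedTotalDegree w (C c : MvPolynomial σ R) = 0 :=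
  isWeightedHomogeneous_zero_iff_weightedTotalDegree_eq_zero.mp (isWeightedHomogeneous_C w c)

/-- A normalised Lagrange factor `C a * (u - C v)` has weighted total degree at most that of the
coordinate `u`. [folklore] -/
theorem weightedTotalDegree_C_mul_sub_C_le (w : σ → ℕ) (a v : R) (u : MvPolynomial σ R) :
    weightedTotalDegree w (C a * (u - C v)) ≤ weightedTotalDegree w u := by
  refine (weightedTotalDegree_mul_le w _ _).trans ?_
  rw [weightedTotalDegree_C, zero_add]
  refine (weightedTotalDegree_sub_le w _ _).trans ?_
  rw [weightedTotalDegree_C]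
  exact max_le le_rfl (Nat.zero_le _)

/-- **Stub `stub_indicator`** (Lagrange through coordinates; BCGPU 2024, Thm 2.10): given
polynomial coordinates `u_i` in the matrix entries, finite value sets `V_i ⊂ ℂ` and target values
`t_i ∈ V_i`, there is ONE polynomial `L` with `wdeg L ≤ Σ_i wdeg(u_i) · (|V_i| − 1)` for the
`(j ∸ i)`-weighted degree, and `L(M) = [∀ i, u_i(M) = t_i]` at every point `M` whose coordinates lie
in `V`.  Witness: `L = ∏_i ∏_{v ∈ V_i ∖ {t_i}} (t_i − v)⁻¹ · (u_i − v)`.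
[BlasiakCohnGrochowPrattUmans2024, Thm 2.10] -/
theorem stub_indicator :
    ∀ (d k : ℕ) (u : Fin k → MvPolynomial (Fin d × Fin d) ℂ) (V : Fin k → Finset ℂ) (t : Fin k → ℂ),
    (∀ i, t i ∈ V i) →
    ∃ L : MvPolynomial (Fin d × Fin d) ℂ,
      MvPolynomial.weightedTotalDegree (fun ij : Fin d × Fin d => (ij.2 : ℕ) - ij.1) L ≤
          ∑ i : Fin k, MvPolynomial.weightedTotalDegree (fun ij : Fin d × Fin d => (ij.2 : ℕ) - ij.1) (u i) *
            ((V i).card - 1) ∧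
      ∀ M : Fin d × Fin d → ℂ, (∀ i, MvPolynomial.eval M (u i) ∈ V i) →
        MvPolynomial.eval M L = if (∀ i, MvPolynomial.eval M (u i) = t i) then 1 else 0 := by
  intro d k u V t ht
  refine ⟨∏ i, ∏ v ∈ (V i).erase (t i), C (t i - v)⁻¹ * (u i - C v), ?_, ?_⟩
  · -- weighted degree: sub-additivity under the double product, `|V_i ∖ {t_i}| = |V_i| - 1` factors
    refine (weightedTotalDegree_prod_le _ _ _).trans (Finset.sum_le_sum fun i _ => ?_)
    refine (weightedTotalDegree_prod_le _ _ _).trans ?_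
    refine (Finset.sum_le_sum fun v _ => weightedTotalDegree_C_mul_sub_C_le _ _ v (u i)).trans ?_
    rw [Finset.sum_const, smul_eq_mul, Finset.card_erase_of_mem (ht i)]
    exact (mul_comm _ _).le
  · -- values: every factor is `1` when `u(M) = t`; otherwise the factor `(i, u_i(M))` vanishes
    intro M hM
    simp only [map_prod, map_mul, map_sub, eval_C]
    split_ifs with hall
    · refine Finset.prod_eq_one fun i _ => Finset.prod_eq_one fun v hv => ?_
      rw [hall i]
      exact inv_mul_cancel₀ (sub_ne_zero.mpr (Finset.ne_of_mem_erase hv).symm)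
    · obtain ⟨i, hi⟩ := not_forall.mp hall
      refine Finset.prod_eq_zero (Finset.mem_univ i) ?_
      refine Finset.prod_eq_zero (Finset.mem_erase.mpr ⟨hi, hM i⟩) ?_
      rw [sub_self, mul_zero]

end NilpotentThresholdDesigns

end Summit.MatrixMultiplication.MatrixMultiplication.Theorems

end
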